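import Summits.MatrixMultiplication.OmegaCensus.STPP211Z2pow6CoverDecide1
import Summits.MatrixMultiplication.OmegaCensus.STPP211Z2pow6CoverDecide2
import Summits.MatrixMultiplication.OmegaCensus.STPP211Z2pow6CoverDecide3

/-!
# (2,1,1)¹⁰ ⊄ (ℤ/2)⁶ — part H3e: THE COVER — every frame normal form is a coordinate permutation away from a listed canonical set

Cell `pub-omega` (unit `pub-omega-stpp-1-g37`), topic `Summits/MatrixMultiplication/OmegaCensus`.
HONEST FRAMING (verbatim): lottery ticket; floor = certified bounds/negative ranges. Census STRUCTURE bookkeeping (B5, `T1((ℤ/2)⁶)`, Pb237);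
nothing here is a bound on `ω`.

Assembly of the chunked kernel decisions (`STPP211Z2pow6CoverDecide1–3`: 462 + 14 950 + 29 260 = 44 672 frames) into `cover_all`, and the
finset reading `cover_spec`: for `d ∈ {4, 5, 6}` and every `R ∈ (free d).powersetCard (9 − d)` there are a checked column list `P`
(`linOK P`, so `lin P` is an injective homomorphism of `G6` — a coordinate permutation) and a row of `certs` whose canonical set `C`
satisfies `(base d ∪ R).image (lin P) = setOf C`. The bridge from finsets to the code lists of the engine goes through the sorted code
list of `R` (a sublist of `freeCodes d` of length `9 − d`, hence a member of `(freeCodes d).sublistsLen (9 − d)`).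
With `STPP211Z2pow6FrameNF.exists_frameNF` and `STPP211Z2pow6NFCertsCheck.certs_spec` this gives `exists_repNF` (part H4,
`STPP211Z2pow6RepNF`).

References: H. Cohn, R. Kleinberg, B. Szegedy, C. Umans, FOCS 2005 (arXiv:math/0511460), Def. 5.1.
-/

namespace Summit.MatrixMultiplication.OmegaCensus

namespace T1Z2p6

open Finset

/-! ## The cover: assembly of the kernel decisions and the finset reading -/

/-- Chunks: a list passes `all` if a prefix and the matching suffix do. -/
theorem all_of_take_drop {α : Type*} {f : α → Bool} {L : List α} (n : ℕ) (h₁ : (L.take n).all f = true)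
    (h₂ : (L.drop n).all f = true) : L.all f = true := by
  rw [← List.take_append_drop n L, List.all_append, h₁, h₂]; rfl

/-- Chunks: a suffix passes `all` if its first `m` elements and the later suffix do. -/
theorem all_drop_of_take_drop {α : Type*} {f : α → Bool} {L : List α} (n m : ℕ) (h₁ : ((L.drop n).take m).all f = true)
    (h₂ : (L.drop (n + m)).all f = true) : (L.drop n).all f = true := by
  apply all_of_take_drop m h₁
  rw [List.drop_drop]
  exact h₂

/-- **KERNEL (assembled): every frame normal form passes the cover check** (`d = 4, 5, 6`; 462 + 14 950 + 29 260 = 44 672 frames). -/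
theorem cover_all : ∀ d ∈ ({4, 5, 6} : Finset ℕ), ((freeCodes d).sublistsLen (9 - d)).all (coverOne d) = true := by
  intro d hd
  simp only [mem_insert, mem_singleton] at hd
  rcases hd with rfl | rfl | rfl
  · exact cover4
  · exact all_of_take_drop 3738 cover5a
      (all_drop_of_take_drop 3738 3738 cover5b (all_drop_of_take_drop 7476 3737 cover5c cover5d))
  · exact all_of_take_drop 5852 cover6a (all_drop_of_take_drop 5852 5852 cover6b
      (all_drop_of_take_drop 11704 5852 cover6c (all_drop_of_take_drop 17556 5852 cover6d cover6e)))

/-- The code list of a subset of `free d` is one of the enumerated free parts. -/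
theorem codes_mem_sublistsLen {d : ℕ} (hd : d ∈ ({4, 5, 6} : Finset ℕ)) {R : Finset G6} (hR : R ∈ (free d).powersetCard (9 - d)) :
    (R.image enc).sort (· ≤ ·) ∈ (freeCodes d).sublistsLen (9 - d) := by
  have hRsub : R ⊆ free d := (mem_powersetCard.1 hR).1
  have hsub : (R.image enc).sort (· ≤ ·) ⊆ freeCodes d := fun n hn => by
    obtain ⟨x, hx, rfl⟩ := mem_image.1 ((Finset.mem_sort _).1 hn)
    exact (mem_free_iff d hd x).1 (hRsub hx)
  refine List.mem_sublistsLen.2 ⟨List.sublist_of_subperm_of_pairwise ((Finset.sort_nodup _ _).subperm hsub)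
    (Finset.pairwise_sort _ _) (freeCodes_sorted d), ?_⟩
  rw [Finset.length_sort, card_image_of_injective _ enc_injective, (mem_powersetCard.1 hR).2]

/-- The code list of `R` describes `R`. -/
theorem setOf_codes (R : Finset G6) : setOf ((R.image enc).sort (· ≤ ·)) = R := by
  ext x
  simp only [setOf, List.mem_toFinset, List.mem_map, Finset.mem_sort, mem_image]
  constructor
  · rintro ⟨_, ⟨y, hy, rfl⟩, rfl⟩; rwa [dec_enc]
  · intro hx; exact ⟨enc x, ⟨x, hx, rfl⟩, dec_enc x⟩

/-- **THE COVER (finset reading): every frame normal form `base d ∪ R` is carried by a checked linear map `lin P` (a coordinate permutation)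
onto one of the 456 listed canonical sets.** -/
theorem cover_spec {d : ℕ} (hd : d ∈ ({4, 5, 6} : Finset ℕ)) {R : Finset G6} (hR : R ∈ (free d).powersetCard (9 - d)) :
    ∃ P, ∃ hP : linOK P = true, ∃ row ∈ certs, (base d ∪ R).image (lin P hP) = setOf row.2.1 := by
  have hd6 : d ≤ 6 := by simp only [mem_insert, mem_singleton] at hd; omega
  set l := (R.image enc).sort (· ≤ ·) with hl
  have hmem := codes_mem_sublistsLen hd hR
  have hl64 : ∀ x ∈ l, x < 64 := fun x hx =>
    lt_of_mem_freeCodes hd6 ((List.mem_sublistsLen.1 hmem).1.subset hx)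
  have hcov : coverOne d l = true := List.all_eq_true.1 (cover_all d hd) l hmem
  obtain ⟨P, hP, row, hrow, hsets⟩ := coverOne_spec hd hl64 hcov
  refine ⟨P, hP, row, hrow, ?_⟩
  have h64 : ∀ x ∈ baseCodes d ++ l, x < 64 := fun x hx => by
    rcases List.mem_append.1 hx with hx | hx
    · exact lt_of_mem_baseCodes hd6 hx
    · exact hl64 x hx
  rw [hsets, setOf_map_linC hP h64, setOf_append, setOf_baseCodes d hd, setOf_codes]

end T1Z2p6

end Summit.MatrixMultiplication.OmegaCensus
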